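import Summits.HodgeConjecture.HodgeConjecture.Theorems.Ring2AbelianAllSpreadFloorPrimitiveClasses
import Literature.AlgebraicGeometry.HodgeTheory.MiddleDimensionReductionComplexGysin
import Literature.AlgebraicGeometry.HodgeTheory.PencilSpreadDescent
import Literature.AlgebraicGeometry.HodgeTheory.HodgeFiltrationModelsReductionProofs
import Literature.AlgebraicGeometry.HodgeTheory.ComplexConjugationHolds
import Literature.AlgebraicGeometry.Motives.AbelianVarietyExistence
import Literature.AlgebraicGeometry.Motives.AbelianVarietyProductDimProofs
import HarnessLib

/-!
# Ring 2 · sub-cell AbelianAll (ALL ABELIAN VARIETIES), SPREADING axis, part XV — `HC_AV` is the Hodge conjecture in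
# the MIDDLE degree of EVEN-dimensional abelian varieties (BFNP Lemma 48 INSIDE abelian varieties); the floor so restricted

HONEST FRAMING (page 1, verbatim): **research route, not a corollary; conditional on HC_CM plus one named
minimal statement.** Nothing in this file proves a case of the Hodge conjecture for a complex abelian variety of
dimension `≥ 4`; the `@[conjecture]` node below is OPEN, is used only as a displayed HYPOTHESIS, and "minimal" is NOT
claimed (LEAD ruling F-ab-4: least node of the typed preorder as it stands, no HC_CM-free converse known).
Seat `pub-hodge-ring2-ab-spread-1`, gen 25; helper file `--supports stmt-HodgeConjecture-16267`
(`RankFourFaces.CMToAbelian`, which stays OPEN). Docstring rev 2 (same gen): F-ab-96 wording only; 0 statement/proof bytes.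

## What is new (gen-24 standing trigger (cc), served here)

The tree reduces the Hodge conjecture to the middle degree of even-dimensional varieties
(`middleDimensionReduction_holds`, BFNP Lemma 48) — but the printed auxiliary variety `Y × ℙʳ` LEAVES the class of
abelian varieties, so that theorem says nothing about the sub-cell statement `HC_AV` (`HodgeAbelianVarieties`). Part
XIV reduced `HC_AV` WITHIN each abelian variety to Lefschetz-primitive classes in the deep middle `2 ≤ p`, `2p ≤ dim A`.
This file runs the PRODUCT HALF of BFNP Lemma 48 inside the class of abelian varieties — `ℙʳ` replaced by an abelian
variety `B` of dimension `r` (`exists_abelianVariety_dim_eq_succ`), the slice `s = (𝟙, 0) : A → A × B` and the projection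
`pr₁` with the tree's CONSTRUCTED Gysin morphisms `complexGysin μ` — with NO named fact (every ingredient is a theorem of
the tree: `exists_smul_isRationalClass_complexGysin`, `isOfHodgeType_complexGysin` fed with
`hodgePQ_independent_of_hodgeModel_holds` / `nonempty_hodgeModel_holds` / `exists_deRhamIsoFamily_holds`, `gysinMap_comp`,
`gysinMap_mem_algebraicClasses_of_isSmoothProjective`, `IsSmoothProjective.tensor_holds`, `nonempty_hardLefschetzNFold_holds`):

* §1 `mem_algebraicClasses_of_prod_middleDegree` — for complex abelian varieties `A`, `B` with `dim A = 2p + r`,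
  `dim B = r`: if every rational `(p+r, p+r)` class in the MIDDLE degree of `A × B` is algebraic, then every rational
  `(p,p)` class `c ∈ H²ᵖ(A)` is algebraic (`c = pr_{1!} s_! c`, `s_! c` a non-zero scalar multiple of a rational
  `(p+r,p+r)` middle class of the `2(p+r)`-fold `A × B`); `mem_algebraicClasses_of_middleCell` — the atlas cell
  `(2p + r, p)` follows from the middle cell `(2(p+r), p+r)`; `mem_algebraicClasses_of_forall_middleDegree` — on every
  complex abelian variety ALL rational `(p,p)` classes are algebraic as soon as the rational middle-degree Hodge classes
  of all even-dimensional complex abelian varieties of dimension `≥ 4` are (`2p > dim A` by hard Lefschetz down to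
  codimension `dim A - p`, then §1; `p ≤ 1` by `algebraicClasses_zero` / Lefschetz `(1,1)`).
* §2 `HC_AV_iff_forall_middleDegree` — **`HC_AV ↔` every rational `(m,m)` class in `H^{2m}` of every complex abelian
  variety of dimension `2m ≥ 4` is algebraic**; `not_HC_AV_iff_exists_middleDegree_not_mem` — a counterexample to
  `HC_AV`, if any, can be taken in the MIDDLE degree of an EVEN-dimensional abelian variety. The atlas reading: the cell
  `(g, p)` with `2p < g` follows from the middle cell `(2g - 2p, g - p)`, and with `2p > g` from `(2p, p)`.
* §3 `HC_AV_iff_forall_even_mem_primitiveClasses` — §2 composed with part XIV §1 ON THE EVEN-DIMENSIONAL variety: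
  `HC_AV ↔` every rational `(p,p)` Λ-primitive class with `2 ≤ p`, `2p ≤ dim A` on every EVEN-dimensional complex
  abelian variety is algebraic (every hard Lefschetz datum `Λ`).
* §4 (the node) `F_CM^{prim,ev} := EvenPrimitiveHodgeFailureSpreadsToCMFibre` — part XIV's `F_CM^prim` with the binder
  restricted to EVEN-dimensional abelian varieties; rows (NO named fact): **`HC_CM ∧ F_CM^{prim,ev} ⟹ HC_AV`** (§3 + part
  VII), `HC_AV ↔ HC_CM ∧ F_CM^{prim,ev}`, `ModCM F_CM^{prim,ev} ↔ CMToAbelian`, collapse with `F_CM^prim`, `F_CM` under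
  `HC_CM`, and the ladder `F_CM ⟹ F_CM^prim ⟹ F_CM^{prim,ev} ⟹ CMToAbelian`.

HONEST LIMITS. (i) The converses `F_CM^{prim,ev} ⟹ F_CM^prim ⟹ F_CM` are NOT proved HC_CM-free (an anchored datum for
the middle class `s_! c` on `A × B` is not an anchored datum for `c` on `A`); under `HC_CM` all three nodes coincide
(each is `↔ HC_AV`). So `F_CM^{prim,ev}` sits BELOW `F_CM^prim` by a typed edge whose reverse is open: the least node
TYPED SO FAR, not a canonical floor — the restriction move is NOT exhausted (REFEREE-AB F-ab-96: `∀ A, ∃ Λ, …`, one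
polarisation datum, one `p`, one degree are weaker-LOOKING sentences by the SAME move, each closing with `HC_CM`, none
typed here) — and "minimal" is not claimed. (ii) The restriction is licensed by a THEOREM (§1–§3): the B_min of record
changes its binder, not its logical strength modulo `HC_CM`. (iii) NOT obtained and NOT claimed: the common refinement
"Λ-primitive AND exactly middle-degree" — the middle class `s_! c = c × [0]` on `A × B` is NOT primitive for the product
polarisation `L' = L_A ⊗ 1 + 1 ⊗ L_B` when `r ≥ 1` (`L' (c × [0]) = (L_A c) × [0] ≠ 0` for `c ≠ 0`, hard Lefschetz on `A`
as `2p < dim A`), and extracting its primitive component needs the Lefschetz decomposition of `H^*(A × B)` relative to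
`L_A ⊗ 1 + 1 ⊗ L_B` (the `sl₂ ⊗ sl₂` Clebsch–Gordan computation), which the tree does not have; §3 instead applies part
XIV's single-variety reduction on the even-dimensional variety. (iv) First instance `dim A = 4`, `p = 2`, `c ∈ P⁴(A)`;
the first odd-dimensional case removed from the binder is `dim A = 5`, `p = 2` (sent to the middle degree `H⁶` of `A × E`).

References: BrosnanFangNiePearlstein2009 (§6 Lemma 48); VoisinHodgeI2002 (§7.3.2, Lemma 7.30; §6.2.3 Thm. 6.25,
Cor. 6.26, Rem. 6.27; Thm. 11.30); FultonYoungTableaux1997 (App. B §B.1, §B.2 Ex. 5); KerrPearlstein2011 (§3.1);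
Deligne1982HodgeCycles (§6, Prop. 6.1); Andre1996Motifs (Lemme 6.3.1); Milne1999 (§7 (H)); SilvermanAEC2009 (III.3.6).
-/

noncomputable section

set_option linter.dupNamespace false

open CategoryTheory AlgebraicGeometry MonoidalCategory
open Literature.AlgebraicGeometry Literature.AlgebraicGeometry.Motives
open Literature.AlgebraicGeometry.HodgeTheory
open Literature.AlgebraicTopology.SingularHomology

namespace Summit.HodgeConjecture.HodgeConjecture.Ring2.AbelianAll

open Summit.HodgeConjecture.HodgeConjecture
open Summit.HodgeConjecture.HodgeConjecture.Theorems
open Summit.HodgeConjecture.HodgeConjecture.Theses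
open Summit.HodgeConjecture.HodgeConjecture.Theses.RankFourFaces (CMAbelianHodge CMToAbelian)
open Summit.HodgeConjecture.HodgeConjecture.Theses.PadicSemiregularLift (HodgeAbelianVarieties)
open Summit.HodgeConjecture.HodgeConjecture.Ring2.Deform (cmLocus)
open Summit.HodgeConjecture.HodgeConjecture.Theorems.HodgeAbelianVarieties.Negative (iff_hodgeConjecture_restricted)

/-! ## §1 The product half of BFNP Lemma 48 inside the class of abelian varieties (fact-free) -/

/-- **The product step, inside abelian varieties.** Let `A`, `B` be complex abelian varieties, `dim A = 2p + r`,
`dim B = r`, and suppose every rational `(p+r, p+r)` class in the middle degree `H^{2(p+r)}` of `A × B` is algebraic.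
Then every rational `(p,p)` class `c ∈ H²ᵖ(A)` is algebraic: for the slice `s = (𝟙, 0) : A → A × B`,
`s_! c = u • ρ` with `u ≠ 0`, `ρ` rational (`exists_smul_isRationalClass_complexGysin`) of type `(p+r, p+r)`
(`isOfHodgeType_complexGysin`, fed with the tree's theorems `hodgePQ_independent_of_hodgeModel_holds`,
`nonempty_hodgeModel_holds`, `exists_deRhamIsoFamily_holds`), so `s_! c` is algebraic, and
`c = (s ≫ pr₁)_! c = pr_{1!}(s_! c)` (`gysinMap_comp`, `gysinMap_id`) lies in `pr_{1!} N^{p+r} ⊆ Nᵖ H²ᵖ(A)`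
(`gysinMap_mem_algebraicClasses_of_isSmoothProjective`) — the printed proof
(`mem_algebraicClasses_of_two_mul_add_eq_of_complexGysin`) with `B` in place of `ℙʳ`.
[cite: BrosnanFangNiePearlstein2009, §6 Lemma 48] [cite: VoisinHodgeI2002, §7.3.2]
[cite: FultonYoungTableaux1997, App. B §B.1, §B.2 Ex. 5] -/
theorem mem_algebraicClasses_of_prod_middleDegree (A B : AbelianVariety ℂ) {p r : ℕ} (hr : 2 * p + r = A.dim)
    (hB : B.dim = r)
    (hmid : ∀ c' : complexBetti (A.prod B).X (2 * (p + r)), IsRationalClass c' →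
      IsOfHodgeType (2 * (p + r)) (A.prod B).X (2 * (p + r)) (p + r) (p + r) c' →
        c' ∈ algebraicClasses (A.prod B).X (p + r))
    (c : complexBetti A.X (2 * p)) (hc : IsRationalClass c) (hpp : IsOfHodgeType A.dim A.X (2 * p) p p c) :
    c ∈ algebraicClasses A.X p := by
  -- an orientation family and the smooth projective data of `A`, `B`, `A × B`
  let μ : OrientationFamily := fun _ _ h ↦ (Motives.ComplexPoints.isOrientableOver ℂ h).some
  have hμ : μ.HasPoincareDuality := OrientationFamily.hasPoincareDuality μ
  have hX : IsSmoothProjective A.dim A.X := AbelianVariety.isSmoothProjective_holds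
  have hP : IsSmoothProjective r B.X := hB ▸ AbelianVariety.isSmoothProjective_holds
  have hXP : IsSmoothProjective (A.dim + r) (A.X ⊗ B.X) := IsSmoothProjective.tensor_holds hX hP
  have hab : 2 * p + 2 * (A.dim + r) = 2 * (p + r) + 2 * A.dim := by omega
  -- the slice `s = (𝟙, 0) : A ⟶ A × B` at the origin `0 = 1 ∈ B(ℂ)` and `c' := s_! c`
  obtain ⟨c', hc'def⟩ : ∃ c' : complexBetti (A.X ⊗ B.X) (2 * (p + r)),
      complexGysin μ hX hXP (Motives.sliceAt A.X (1 : B.Points ℂ)) hab c = c' := ⟨_, rfl⟩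
  -- `c' = u • ρ`, `u ≠ 0`, `ρ` rational
  obtain ⟨u, hu0, hu⟩ := exists_smul_isRationalClass_complexGysin μ hX hXP (Motives.sliceAt A.X (1 : B.Points ℂ)) hab
  obtain ⟨ρ, hρrat, hρ⟩ := hu c hc
  -- `c'` is of type `(p+r, p+r)` on the `(dim A + r)`-fold `A × B`
  have hc'typ : IsOfHodgeType (A.dim + r) (A.X ⊗ B.X) (2 * (p + r)) (p + r) (p + r) c' := by
    rw [← hc'def]
    exact isOfHodgeType_complexGysin hodgePQ_independent_of_hodgeModel_holds (fun _ _ ↦ nonempty_hodgeModel_holds)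
      (fun E _ _ _ ↦ Literature.NumberTheory.Transcendental.exists_deRhamIsoFamily_holds E) μ hX hXP _ hab
      (by omega) (by omega) hpp
  -- `A × B` has the even dimension `dim A + r = 2(p+r)`: `ρ = u⁻¹ • c'` is a rational middle Hodge class, algebraic
  have hdim : A.dim + r = 2 * (p + r) := by omega
  rw [hdim] at hc'typ
  have hρeq : ρ = u⁻¹ • c' := by
    rw [← hc'def, hρ, smul_smul, inv_mul_cancel₀ hu0, one_smul]
  have hρalg : ρ ∈ algebraicClasses (A.X ⊗ B.X) (p + r) := hmid ρ hρrat (hρeq ▸ hc'typ.smul u⁻¹)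
  have hc'alg : c' ∈ algebraicClasses (A.X ⊗ B.X) (p + r) := by
    rw [← hc'def, hρ]
    exact Submodule.smul_mem _ u hρalg
  -- `c = (s ≫ pr₁)_! c = pr_{1!} (s_! c)`
  have hcc : gysinMap (μ hXP) (μ hX)
      (Motives.AlgPoints.mapContinuous (L := ℂ) (CartesianMonoidalCategory.fst A.X B.X))
      (show 2 * (p + r) + (2 * A.dim - 2 * p) = 2 * (A.dim + r) by omega)
      (show 2 * p + (2 * A.dim - 2 * p) = 2 * A.dim by omega) c' = c := by
    rw [← hc'def, complexGysin_eq_gysinMap hX hXP (Motives.sliceAt A.X (1 : B.Points ℂ)) _ (q := 2 * A.dim - 2 * p)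
        (by omega) (by omega),
      ← LinearMap.comp_apply, ← gysinMap_comp (hμ hXP), ← Motives.AlgPoints.mapContinuous_comp,
      Motives.sliceAt_fst, Motives.AlgPoints.mapContinuous_id, gysinMap_id (hμ hX), LinearMap.id_apply]
  -- `pr_{1!}` maps `N^{p+r} H^{2(p+r)}((A × B)(ℂ))` into `Nᵖ H²ᵖ(A(ℂ))`
  rw [← hcc]
  exact gysinMap_mem_algebraicClasses_of_isSmoothProjective hXP hX (μ hXP) (μ hX) (hμ hX)
    (CartesianMonoidalCategory.fst A.X B.X) _ _ (by omega) hc'alg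

/-- **The atlas reading of the product step: the cell `(g, p)` with `g = 2p + r` follows from the MIDDLE cell
`(2(p+r), p+r) = (2g - 2p, g - p)`** (fact-free). If every rational `(p+r, p+r)` class in the middle degree of every
complex abelian variety of dimension `2(p+r)` is algebraic, then every rational `(p,p)` class on every complex abelian
variety `A` of dimension `2p + r` is algebraic: `r = 0` is the hypothesis on `A` itself, `r ≥ 1` the product step
`mem_algebraicClasses_of_prod_middleDegree` with an abelian variety `B` of dimension `r` (a power of an elliptic curve,
`exists_abelianVariety_dim_eq_succ`). [cite: BrosnanFangNiePearlstein2009, §6 Lemma 48 (proof, case dim Y < 2k)]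
[cite: SilvermanAEC2009, III.3.6] -/
theorem mem_algebraicClasses_of_middleCell (A : AbelianVariety ℂ) {p r : ℕ} (hr : 2 * p + r = A.dim)
    (hmid : ∀ (B : AbelianVariety ℂ), B.dim = 2 * (p + r) →
      ∀ c' : complexBetti B.X (2 * (p + r)), IsRationalClass c' →
        IsOfHodgeType (2 * (p + r)) B.X (2 * (p + r)) (p + r) (p + r) c' → c' ∈ algebraicClasses B.X (p + r))
    (c : complexBetti A.X (2 * p)) (hc : IsRationalClass c) (hpp : IsOfHodgeType A.dim A.X (2 * p) p p c) :
    c ∈ algebraicClasses A.X p := by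
  rcases r with _ | r'
  · -- `r = 0`: `c` is already a middle-degree class of the even-dimensional `A`
    have hA : A.dim = 2 * p := by omega
    have hpp' : IsOfHodgeType (2 * p) A.X (2 * p) p p c := by rw [hA] at hpp; exact hpp
    exact hmid A (by omega) c hc hpp'
  · -- `r = r' + 1 ≥ 1`: product with an abelian variety of dimension `r' + 1`
    obtain ⟨B, hB⟩ := exists_abelianVariety_dim_eq_succ ℂ r'
    exact mem_algebraicClasses_of_prod_middleDegree A B hr hB
      (fun c' hc' hpp' ↦ hmid (A.prod B) (by rw [AbelianVariety.dim_prod, hB]; omega) c' hc' hpp') c hc hpp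

/-- **On a complex abelian variety every rational `(p,p)` class is algebraic as soon as the rational MIDDLE-degree
Hodge classes of all EVEN-dimensional complex abelian varieties of dimension `≥ 4` are** (fact-free): `p = 0`
(`algebraicClasses_zero`); `dim A < 2p` by hard Lefschetz down to codimension `dim A - p`
(`HardLefschetzNFold.mem_algebraicClasses_of_lt_holds`, the tree's theorem); `2p ≤ dim A`, `p ≥ 1`: `r := dim A - 2p`,
`(p, r) = (1, 0)` is Lefschetz `(1,1)` on an abelian surface (`lefschetzOneOne_rational_holds`), and `p + r ≥ 2` is
`mem_algebraicClasses_of_middleCell`. [cite: BrosnanFangNiePearlstein2009, §6 Lemma 48] [cite: KerrPearlstein2011, §3.1]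
[cite: VoisinHodgeI2002, Thm. 6.25, Rem. 6.27, §7.3.2 and Thm. 11.30] -/
theorem mem_algebraicClasses_of_forall_middleDegree (A : AbelianVariety ℂ)
    (hmid : ∀ (B : AbelianVariety ℂ) (m : ℕ), 2 ≤ m → B.dim = 2 * m →
      ∀ c' : complexBetti B.X (2 * m), IsRationalClass c' → IsOfHodgeType (2 * m) B.X (2 * m) m m c' →
        c' ∈ algebraicClasses B.X m) :
    ∀ (p : ℕ) (c : complexBetti A.X (2 * p)), IsRationalClass c → IsOfHodgeType A.dim A.X (2 * p) p p c →
      c ∈ algebraicClasses A.X p := by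
  have hX : IsSmoothProjective A.dim A.X := AbelianVariety.isSmoothProjective_holds
  -- the half `2p ≤ dim A`
  have hle : ∀ p : ℕ, 2 * p ≤ A.dim → ∀ c : complexBetti A.X (2 * p), IsRationalClass c →
      IsOfHodgeType A.dim A.X (2 * p) p p c → c ∈ algebraicClasses A.X p := by
    intro p h2p c hc hpp
    rcases Nat.eq_zero_or_pos p with rfl | hp
    · rw [algebraicClasses_zero]
      exact Submodule.mem_top
    obtain ⟨r, hr⟩ : ∃ r, 2 * p + r = A.dim := ⟨A.dim - 2 * p, by omega⟩
    rcases Nat.lt_or_ge (p + r) 2 with hsmall | hbig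
    · -- `p = 1`, `r = 0`: an abelian surface, Lefschetz `(1,1)`
      obtain rfl : p = 1 := by omega
      exact lefschetzOneOne_rational_holds hX c hc hpp
    · exact mem_algebraicClasses_of_middleCell A hr (fun B hB c' hc' hpp' ↦ hmid B (p + r) hbig hB c' hc' hpp') c hc hpp
  intro p c hc hpp
  rcases Nat.lt_or_ge A.dim (2 * p) with hlt | hge
  · -- above the middle: hard Lefschetz down to codimension `dim A - p`, then the first half
    exact HardLefschetzNFold.mem_algebraicClasses_of_lt_holds hX hlt
      (fun c' hc' hpp' ↦ hle (A.dim - p) (by omega) c' hc' hpp') c hc hpp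
  · exact hle p hge c hc hpp

/-! ## §2 `HC_AV` is the Hodge conjecture in the middle degree of even-dimensional abelian varieties -/

/-- **`HC_AV ↔` every rational `(m,m)` class in the middle degree `H^{2m}` of every complex abelian variety of even
dimension `2m ≥ 4` is algebraic** — NO named fact (BFNP Lemma 48 inside the class of abelian varieties: §1, hard
Lefschetz `nonempty_hardLefschetzNFold_holds`, Lefschetz `(1,1)` `lefschetzOneOne_rational_holds`, Hodge models
`nonempty_hodgeModel_holds`; compare the tree's `hodgeConjectureFor_of_middleDimension_holds`, whose auxiliary
variety `X × ℙʳ` is not an abelian variety). [cite: BrosnanFangNiePearlstein2009, §6 Lemma 48]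
[cite: KerrPearlstein2011, §3.1] [cite: VoisinHodgeI2002, Thm. 6.25, Rem. 6.27 and §7.3.2] -/
theorem HC_AV_iff_forall_middleDegree :
    HodgeAbelianVarieties ↔
      ∀ (A : AbelianVariety ℂ) (m : ℕ), 2 ≤ m → A.dim = 2 * m →
        ∀ c : complexBetti A.X (2 * m), IsRationalClass c → IsOfHodgeType (2 * m) A.X (2 * m) m m c →
          c ∈ algebraicClasses A.X m := by
  refine ⟨fun h A m _ hA c hc hpp ↦ (h A).2 m c hc (by rw [hA]; exact hpp), fun h ↦ ?_⟩
  refine iff_hodgeConjecture_restricted.2 fun A hA ↦ ?_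
  exact (hodgeConjectureFor_iff_of_isSmoothProjective nonempty_hodgeModel_holds hA).2
    (mem_algebraicClasses_of_forall_middleDegree A h)

/-- **A counterexample to `HC_AV`, if any, can be taken in the MIDDLE degree of an EVEN-dimensional abelian variety of
dimension `≥ 4`** — NO named fact. [cite: BrosnanFangNiePearlstein2009, §6 Lemma 48] [cite: KerrPearlstein2011, §3.1] -/
theorem not_HC_AV_iff_exists_middleDegree_not_mem :
    ¬ HodgeAbelianVarieties ↔
      ∃ (A : AbelianVariety ℂ) (m : ℕ), 2 ≤ m ∧ A.dim = 2 * m ∧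
        ∃ c : complexBetti A.X (2 * m), IsRationalClass c ∧ IsOfHodgeType (2 * m) A.X (2 * m) m m c ∧
          c ∉ algebraicClasses A.X m := by
  rw [HC_AV_iff_forall_middleDegree]
  constructor
  · intro h
    by_contra hne
    exact h fun A m h2 hA c hc hpp ↦ by_contra fun hnc ↦ hne ⟨A, m, h2, hA, c, hc, hpp, hnc⟩
  · rintro ⟨A, m, h2, hA, c, hc, hpp, hnc⟩ h
    exact hnc (h A m h2 hA c hc hpp)

/-! ## §3 Composition with part XIV: `HC_AV` is the Hodge conjecture for deep-middle PRIMITIVE classes on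
EVEN-dimensional abelian varieties -/

/-- **`HC_AV ↔` every rational `(p,p)` Λ-primitive class with `2 ≤ p`, `2p ≤ dim A` on every EVEN-dimensional complex
abelian variety is algebraic** — for EVERY choice of hard Lefschetz data, NO named fact: §2 puts a counterexample in
the middle degree of an even-dimensional abelian variety `A'`, and part XIV's single-variety reduction
`mem_algebraicClasses_of_forall_mem_primitiveClasses` ON `A'` (any `Λ`, `nonempty_hardLefschetzNFold_holds`) makes all
classes of `A'` algebraic from its deep-middle primitive ones. [cite: BrosnanFangNiePearlstein2009, §6 Lemma 48]
[cite: VoisinHodgeI2002, Thm. 6.25, Cor. 6.26, Rem. 6.27 and Thm. 11.30] [cite: KerrPearlstein2011, §3.1] -/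
theorem HC_AV_iff_forall_even_mem_primitiveClasses :
    HodgeAbelianVarieties ↔
      ∀ (A : AbelianVariety ℂ) (Λ : HardLefschetzNFold A.dim A.X) (p : ℕ), Even A.dim → 2 ≤ p → 2 * p ≤ A.dim →
        ∀ c : complexBetti A.X (2 * p), IsRationalClass c → IsOfHodgeType A.dim A.X (2 * p) p p c →
          c ∈ primitiveClasses Λ.hyperplaneClass A.dim (2 * p) → c ∈ algebraicClasses A.X p := by
  refine ⟨fun h A _ p _ _ _ c hc hpp _ ↦ (h A).2 p c hc hpp, fun h ↦ HC_AV_iff_forall_middleDegree.2 ?_⟩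
  intro A m _ hA c hc hpp
  have hX : IsSmoothProjective A.dim A.X := AbelianVariety.isSmoothProjective_holds
  obtain ⟨Λ⟩ := nonempty_hardLefschetzNFold_holds A.dim A.X hX
  have hev : Even A.dim := ⟨m, by omega⟩
  exact mem_algebraicClasses_of_forall_mem_primitiveClasses hX Λ
    (fun p h2p h2pn c' hc' hpp' hprim ↦ h A Λ p hev h2p h2pn c' hc' hpp' hprim) m c hc (by rw [hA]; exact hpp)

/-- **`¬ HC_AV` iff some EVEN-dimensional complex abelian variety carries, for EVERY hard Lefschetz datum `Λ`, a rational
`(p,p)` Λ-primitive non-algebraic class with `2 ≤ p`, `2p ≤ dim A`** — NO named fact.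
[cite: BrosnanFangNiePearlstein2009, §6 Lemma 48] [cite: VoisinHodgeI2002, Cor. 6.26] [cite: KerrPearlstein2011, §3.1] -/
theorem not_HC_AV_iff_exists_even_mem_primitiveClasses_not_mem :
    ¬ HodgeAbelianVarieties ↔
      ∃ A : AbelianVariety ℂ, Even A.dim ∧ ∀ Λ : HardLefschetzNFold A.dim A.X,
        ∃ (p : ℕ), 2 ≤ p ∧ 2 * p ≤ A.dim ∧ ∃ c : complexBetti A.X (2 * p),
          IsRationalClass c ∧ IsOfHodgeType A.dim A.X (2 * p) p p c ∧
            c ∈ primitiveClasses Λ.hyperplaneClass A.dim (2 * p) ∧ c ∉ algebraicClasses A.X p := by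
  constructor
  · intro h
    by_contra hall
    push Not at hall
    refine h (HC_AV_iff_forall_even_mem_primitiveClasses.2 fun A _ p hev _ _ c hc hpp _ ↦ ?_)
    obtain ⟨Λ₀, hΛ₀⟩ := hall A hev
    -- all deep-middle Λ₀-primitive classes of `A` are algebraic, hence ALL classes of `A` are (part XIV §1)
    exact mem_algebraicClasses_of_forall_mem_primitiveClasses (AbelianVariety.isSmoothProjective_holds (A := A)) Λ₀
      hΛ₀ p c hc hpp
  · rintro ⟨A, _, hA⟩ hAV
    obtain ⟨Λ⟩ := nonempty_hardLefschetzNFold_holds A.dim A.X (AbelianVariety.isSmoothProjective_holds (A := A))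
    obtain ⟨p, _, _, c, hc, hpp, _, hnc⟩ := hA Λ
    exact hnc ((hAV A).2 p c hc hpp)

/-! ## §4 The node `F_CM^{prim,ev}` and its fact-free rows -/

/-- **`F_CM^{prim,ev}` — HODGE FAILURES OF LEFSCHETZ-PRIMITIVE DEEP-MIDDLE CLASSES ON EVEN-DIMENSIONAL ABELIAN VARIETIES
SPREAD TO A CM FIBRE** (research node; part XIV's `PrimitiveHodgeFailureSpreadsToCMFibre` with its binder RESTRICTED to
even-dimensional abelian varieties). For every complex abelian variety `A` of EVEN dimension, every hard Lefschetz datum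
`Λ`, every `p` with `2 ≤ p`, `2p ≤ dim A`, and every rational `(p,p)` class `c ∈ P^{2p}(A)` which is NOT algebraic,
there are an anchored datum `(f, s, W)` for `(A, p, c)` (part VII §A) and a CM fibre `s' ∈ cmLocus f n` at which `W` is
NOT algebraic. KERNEL (this file, NO named fact): `HC_AV ↔ HC_CM ∧ F_CM^{prim,ev}`, `F_CM ⟹ F_CM^prim ⟹ F_CM^{prim,ev}`
(converses open HC_CM-free; all three coincide under `HC_CM`). OPEN; no print locator of its own; a HYPOTHESIS wherever
used; never asserted; "minimal" not claimed (F-ab-4). First instance `dim A = 4`, `p = 2`, `c ∈ ker([H] ∪ ·)`.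
[cite: Deligne1982HodgeCycles, Prop. 6.1, Thm. 2.12 and Prop. 2.9] [cite: VoisinHodgeI2002, §6.2.3 Def. 6.24 and
Cor. 6.26] [cite: BrosnanFangNiePearlstein2009, §6 Lemma 48] [cite: Andre1996Motifs, Lemme 6.3.1 (p. 31)] [status: open] -/
@[conjecture] def EvenPrimitiveHodgeFailureSpreadsToCMFibre : Prop :=
  ∀ (A : AbelianVariety ℂ), IsSmoothProjective A.dim A.X → Even A.dim → ∀ (Λ : HardLefschetzNFold A.dim A.X)
    (p : ℕ), 2 ≤ p → 2 * p ≤ A.dim →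
      ∀ (c : complexBetti A.X (2 * p)), IsRationalClass c → IsOfHodgeType A.dim A.X (2 * p) p p c →
        c ∈ primitiveClasses Λ.hyperplaneClass A.dim (2 * p) → c ∉ algebraicClasses A.X p →
          ∃ (n : ℕ) (𝒳 S : SchemeOver ℂ) (f : 𝒳 ⟶ S) (s : ComplexPoints S) (W : complexBetti 𝒳 (2 * p)),
            IsCMAnchoredDatumFor A p c f n s W ∧
              ∃ s' ∈ cmLocus f n, complexBetti.map (fiberι f s') (2 * p) W ∉ algebraicClasses (fiberOver f s') p

/-- **`F_CM^prim ⟹ F_CM^{prim,ev}`**, NO fact: forget the parity binder. [folklore] -/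
theorem evenPrimitiveHodgeFailureSpreadsToCMFibre_of_primitiveHodgeFailureSpreadsToCMFibre
    (h : PrimitiveHodgeFailureSpreadsToCMFibre) : EvenPrimitiveHodgeFailureSpreadsToCMFibre :=
  fun A hA _ Λ p h2 h2p c hc hpp hprim hnc ↦ h A hA Λ p h2 h2p c hc hpp hprim hnc

/-- **`F_CM ⟹ F_CM^{prim,ev}`**, NO fact (through part XIV). [folklore] -/
theorem evenPrimitiveHodgeFailureSpreadsToCMFibre_of_hodgeFailureSpreadsToCMFibre (h : HodgeFailureSpreadsToCMFibre) :
    EvenPrimitiveHodgeFailureSpreadsToCMFibre :=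
  evenPrimitiveHodgeFailureSpreadsToCMFibre_of_primitiveHodgeFailureSpreadsToCMFibre
    (primitiveHodgeFailureSpreadsToCMFibre_of_hodgeFailureSpreadsToCMFibre h)

/-- **`HC_AV_of_HC_CM_and_evenPrimitiveHodgeFailureSpreadsToCMFibre` — the brief's `HC_AV_of_HC_CM_and_Bmin` with
`B_min := F_CM^{prim,ev}` and EXACTLY two hypotheses**: `HC_CM → F_CM^{prim,ev} → HC_AV`, NO named fact. By §3 it suffices
to treat a rational `(p,p)` Λ-primitive class with `2 ≤ p`, `2p ≤ dim A` on an EVEN-dimensional `A`; were it not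
algebraic, F_CM^{prim,ev} gives an anchored datum and a CM fibre where `W` is NOT algebraic, while `HC_CM` makes `W`
algebraic at every CM fibre (part VII) — contradiction. [cite: BrosnanFangNiePearlstein2009, §6 Lemma 48]
[cite: Deligne1982HodgeCycles, §6 proof of Thm. 2.11 (pp. 71–73)] [cite: Milne1999, §7 p. 72 (hypothesis (H))] -/
theorem HC_AV_of_HC_CM_and_evenPrimitiveHodgeFailureSpreadsToCMFibre (hCM : CMAbelianHodge)
    (h : EvenPrimitiveHodgeFailureSpreadsToCMFibre) : HodgeAbelianVarieties := by
  refine HC_AV_iff_forall_even_mem_primitiveClasses.2 fun A Λ p hev h2 h2p c hc hpp hprim ↦ ?_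
  by_contra hnc
  obtain ⟨n, 𝒳, S, f, s, W, hd, s', hs', hns'⟩ :=
    h A (AbelianVariety.isSmoothProjective_holds (A := A)) hev Λ p h2 h2p c hc hpp hprim hnc
  exact hns' (forall_cmLocus_mem_algebraicClasses_of_HC_CM_of_isCMAnchoredDatumFor hCM hd s' hs')

/-- F_CM^{prim,ev} closes with `HC_CM`, NO fact (LEAD grammar). [folklore] -/
theorem closesWithCM_evenPrimitiveHodgeFailureSpreadsToCMFibre : ClosesWithCM EvenPrimitiveHodgeFailureSpreadsToCMFibre :=
  fun hCM h ↦ HC_AV_of_HC_CM_and_evenPrimitiveHodgeFailureSpreadsToCMFibre hCM h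

/-- Hence `F_CM^{prim,ev} ⟹ CMToAbelian` outright (a typed conditional TOWARD stmt-HodgeConjecture-16267, which stays
OPEN). [folklore] -/
theorem cmToAbelian_of_evenPrimitiveHodgeFailureSpreadsToCMFibre : EvenPrimitiveHodgeFailureSpreadsToCMFibre → CMToAbelian :=
  cmToAbelian_of_closesWithCM closesWithCM_evenPrimitiveHodgeFailureSpreadsToCMFibre

/-- **ON-PATH with NO fact: `HC_AV ⟹ F_CM^{prim,ev}`** — under `HC_AV` nothing triggers it. [folklore] -/
theorem onPathAV_evenPrimitiveHodgeFailureSpreadsToCMFibre : OnPathAV EvenPrimitiveHodgeFailureSpreadsToCMFibre :=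
  fun hAV A _ _ _ p _ _ c hc hpp _ hnc ↦ absurd ((hAV A).2 p c hc hpp) hnc

/-- **EXACTNESS, NO named fact: `HC_AV ↔ (HC_CM ∧ F_CM^{prim,ev})`** (in print `HC_CM` is not known from it). [folklore] -/
theorem exactWithCM_evenPrimitiveHodgeFailureSpreadsToCMFibre : ExactWithCM EvenPrimitiveHodgeFailureSpreadsToCMFibre :=
  exactWithCM_iff.2
    ⟨closesWithCM_evenPrimitiveHodgeFailureSpreadsToCMFibre, onPathAV_evenPrimitiveHodgeFailureSpreadsToCMFibre⟩

/-- The same, unfolded: `HC_AV ↔ (HC_CM ∧ F_CM^{prim,ev})`, NO named fact. [folklore] -/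
theorem HC_AV_iff_HC_CM_and_evenPrimitiveHodgeFailureSpreadsToCMFibre :
    HodgeAbelianVarieties ↔ (CMAbelianHodge ∧ EvenPrimitiveHodgeFailureSpreadsToCMFibre) :=
  exactWithCM_evenPrimitiveHodgeFailureSpreadsToCMFibre

/-- Relativised to `HC_CM`, the node IS the item: `ModCM F_CM^{prim,ev} ↔ CMToAbelian`, NO named fact. [folklore] -/
theorem modCM_evenPrimitiveHodgeFailureSpreadsToCMFibre_iff_cmToAbelian :
    ModCM EvenPrimitiveHodgeFailureSpreadsToCMFibre ↔ CMToAbelian :=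
  modCM_iff_cmToAbelian_of_exactWithCM exactWithCM_evenPrimitiveHodgeFailureSpreadsToCMFibre

/-- Under `HC_CM` alone (no print), `F_CM^{prim,ev} ↔ HC_AV`. [folklore] -/
theorem evenPrimitiveHodgeFailureSpreadsToCMFibre_iff_HC_AV_of_HC_CM (hCM : CMAbelianHodge) :
    EvenPrimitiveHodgeFailureSpreadsToCMFibre ↔ HodgeAbelianVarieties :=
  iff_HC_AV_of_exactWithCM_of_HC_CM exactWithCM_evenPrimitiveHodgeFailureSpreadsToCMFibre hCM

/-- COLLAPSE under `HC_CM` alone (no print): `F_CM^{prim,ev} ↔ F_CM^prim` and `F_CM^{prim,ev} ↔ F_CM`; the HC_CM-free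
converses are NOT claimed. [folklore] -/
theorem evenPrimitiveHodgeFailureSpreadsToCMFibre_iff_of_HC_CM (hCM : CMAbelianHodge) :
    (EvenPrimitiveHodgeFailureSpreadsToCMFibre ↔ PrimitiveHodgeFailureSpreadsToCMFibre) ∧
      (EvenPrimitiveHodgeFailureSpreadsToCMFibre ↔ HodgeFailureSpreadsToCMFibre) :=
  ⟨(evenPrimitiveHodgeFailureSpreadsToCMFibre_iff_HC_AV_of_HC_CM hCM).trans
      (primitiveHodgeFailureSpreadsToCMFibre_iff_HC_AV_of_HC_CM hCM).symm,
    (evenPrimitiveHodgeFailureSpreadsToCMFibre_iff_HC_AV_of_HC_CM hCM).trans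
      (hodgeFailureSpreadsToCMFibre_iff_HC_AV_of_HC_CM hCM).symm⟩

/-- ON-PATH from the summit, NO fact. [folklore] -/
theorem evenPrimitiveHodgeFailureSpreadsToCMFibre_of_hodgeConjecture (hHC : _root_.HodgeConjecture) :
    EvenPrimitiveHodgeFailureSpreadsToCMFibre :=
  of_onPathAV_of_hodgeConjecture onPathAV_evenPrimitiveHodgeFailureSpreadsToCMFibre hHC

/-- **The B_min ladder of the spreading axis at this node, NO named fact**: `F_CM ⟹ F_CM^prim ⟹ F_CM^{prim,ev} ⟹
CMToAbelian`, and `HC_AV ↔ HC_CM ∧ F_CM ↔ HC_CM ∧ F_CM^prim ↔ HC_CM ∧ F_CM^{prim,ev}`. [folklore] -/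
theorem spreadFloor_evenPrimitive_ladder :
    (HodgeFailureSpreadsToCMFibre → PrimitiveHodgeFailureSpreadsToCMFibre) ∧
      (PrimitiveHodgeFailureSpreadsToCMFibre → EvenPrimitiveHodgeFailureSpreadsToCMFibre) ∧
      (EvenPrimitiveHodgeFailureSpreadsToCMFibre → CMToAbelian) ∧
      (HodgeAbelianVarieties ↔ (CMAbelianHodge ∧ HodgeFailureSpreadsToCMFibre)) ∧
      (HodgeAbelianVarieties ↔ (CMAbelianHodge ∧ PrimitiveHodgeFailureSpreadsToCMFibre)) ∧
      (HodgeAbelianVarieties ↔ (CMAbelianHodge ∧ EvenPrimitiveHodgeFailureSpreadsToCMFibre)) :=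
  ⟨primitiveHodgeFailureSpreadsToCMFibre_of_hodgeFailureSpreadsToCMFibre,
    evenPrimitiveHodgeFailureSpreadsToCMFibre_of_primitiveHodgeFailureSpreadsToCMFibre,
    cmToAbelian_of_evenPrimitiveHodgeFailureSpreadsToCMFibre, HC_AV_iff_HC_CM_and_hodgeFailureSpreadsToCMFibre,
    HC_AV_iff_HC_CM_and_primitiveHodgeFailureSpreadsToCMFibre, HC_AV_iff_HC_CM_and_evenPrimitiveHodgeFailureSpreadsToCMFibre⟩

end Summit.HodgeConjecture.HodgeConjecture.Ring2.AbelianAll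

end
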